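import Mathlib
import HarnessLib
import Summits.Ventures.LatticeQCDFlow.Scaling.AutoregressiveGaugeHeatBathVolumeFloor

/-!
# LatticeQCDFlow / Scaling — the frozen event can be made rare: `sup_f τ_int(f) ≥ 1/(ε + 2(M₂/M)^s) − 1/2`
# for every `ε > 0`, whenever the top level set of the weight is Haar-null

HONEST FRAMING: exact (Metropolis-corrected) sampling algorithms for lattice gauge theory;
figures of merit are autocorrelation/cost numbers at stated couplings and volumes; no
continuum-physics claim.

Venture `LatticeQCDFlow` (cell pub-lqcd), topic `Scaling`, FANOUT row 30 (lean-1, GEN-26) — OUR WORK on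
THEORY-2.md §4 row C5.  `Scaling/AutoregressiveGaugeHeatBathVolumeFloor` proved, for the exact sampler
with the block proposal of a ranked structure carrying a closing section of size `s`, that every event
`A ⊆ {F_R > θ M^k}` of positive target probability has `τ_int(1_A − π(A)) ≥ 1/(π(A) + (M₂/M)^s/θ) − 1/2`.
The bound is of order `(M/M₂)^s` only if `π(A)` is small.  Here: it can always be made small when the
weight's top level set `{w = M}` is Haar-null and `k ≥ 1` — the events `A_θ = {F_R > θ M^k}` are open
neighbourhoods of the cold configuration (positive target probability) and decrease, as `θ ↑ 1`, to
`{F_R = M^k} ⊆ {w(U_{p₀}) = M}` (`p₀` any uncovered plaquette), a target-null set because the law of a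
single plaquette holonomy under `Haar^{⊗E}` is Haar.

* §1 **`pi_haar_real_plaquetteHolonomy_preimage`** — `Haar^{⊗E}{U : U_p ∈ N} = Haar(N)` (one-link redraw);
* §2 **`pi_haar_prodWeight_eq_max_null`** — `Haar^{⊗E}{F_R = M^k} = 0` when `Haar{w = M} = 0`, `k ≥ 1`;
* §3 **`closing_event_tauInt_ge_of_null`** — in the setting of `closing_volumeFloor`, with `w(1) = M`
  and `Haar{w = M} = 0`: for every `ε > 0` there is an event `A` with `0 < π(A) < ε` and
  `τ_int(1_A − π(A)) ≥ 1/(ε + 2·(M₂/M)^s) − 1/2`.  With `Scaling/TorusClosingSection` /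
  `…VolumeLaw` (`s ≥ k_min/(2d−3)`) and `Scaling/PlaquetteTwoWeightConstant` (`M₂ < M`): in every
  `d ≥ 3` the supremum of `τ_int` over bounded observables of the optimal exact one-plaquette heat-bath
  sampler grows at least like `(M/M₂)^{k_min(d,L)/(2d−3)}/2` — EXPONENTIALLY IN THE VOLUME — while GEN-24's
  ceiling is `(M/m)^{k_min}`.

NOT CLAIMED: a volume-growing `τ_int` for the plaquette or other smooth observables in stationarity.
No `def`, no `sorry`, nothing cited as a fact.
-/

noncomputable section

namespace Summit.Ventures.LatticeQCDFlow.Theory2.Autoregressive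

open MeasureTheory ProbabilityTheory Function Finset Filter
open Summit.Ventures.LatticeQCDFlow.Exactness Summit.Ventures.LatticeQCDFlow.Scoring
open Literature.MathematicalPhysics.QuantumFieldTheory Literature.MathematicalPhysics.QuantumLattice
open scoped ENNReal Topology

variable {d L : ℕ} [NeZero L] {G : Type*} [Group G] [TopologicalSpace G] [IsTopologicalGroup G]
  [CompactSpace G] [SecondCountableTopology G] [MeasurableSpace G] [BorelSpace G]

/-! ## §1 The law of one plaquette holonomy under `Haar^{⊗E}` is Haar -/

/-- **`Haar^{⊗E}{U : U_p ∈ N} = Haar(N)`** for every plaquette `p = (x; i, j)` (`i ≠ j`, `L ≥ 2`) and every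
measurable `N ⊆ G`: redraw the first link of `p`. [ours] -/
theorem pi_haar_real_plaquetteHolonomy_preimage (hL : 2 ≤ L) (x : Site d L) {i j : Fin d} (hij : i ≠ j)
    {N : Set G} (hN : MeasurableSet N) :
    (Measure.pi fun _ : Edge d L => haarProbability G).real {U | plaquetteHolonomy U x i j ∈ N} =
      (haarProbability G).real N := by
  have hmeas : MeasurableSet {U : GaugeConfig d L G | plaquetteHolonomy U x i j ∈ N} :=
    hN.preimage (measurable_plaquetteHolonomy x i j)
  have h := integral_comp_plaquetteHolonomy_mul_of_mem (G := G) hL x hij (e := (x, i)) (by simp)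
    (H := N.indicator fun _ => (1 : ℝ)) (measurable_const.indicator hN) (C := 1)
    (fun g => by
      by_cases hg : g ∈ N
      · rw [Set.indicator_of_mem hg, abs_one]
      · rw [Set.indicator_of_notMem hg, abs_zero]; exact zero_le_one)
    (Φ := fun _ => (1 : ℝ)) measurable_const (C' := 1) (fun _ => by rw [abs_one]) (fun _ _ => rfl)
  simp only [mul_one, integral_const, smul_eq_mul, probReal_univ] at h
  rw [integral_indicator_const (1 : ℝ) hN, smul_eq_mul, mul_one] at h
  have e : (fun U : GaugeConfig d L G => N.indicator (fun _ => (1 : ℝ)) (plaquetteHolonomy U x i j)) =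
      {U : GaugeConfig d L G | plaquetteHolonomy U x i j ∈ N}.indicator fun _ => (1 : ℝ) := by
    funext U
    by_cases hU : plaquetteHolonomy U x i j ∈ N
    · rw [Set.indicator_of_mem hU, Set.indicator_of_mem (show U ∈ {U | plaquetteHolonomy U x i j ∈ N} from hU)]
    · rw [Set.indicator_of_notMem hU,
        Set.indicator_of_notMem (show U ∉ {U | plaquetteHolonomy U x i j ∈ N} from hU)]
  rw [e, integral_indicator_const (1 : ℝ) hmeas, smul_eq_mul, mul_one] at h
  exact h

/-! ## §2 The top level set of `F_R` is null -/

/-- **`Haar^{⊗E}{F_R = M^k} = 0`.**  `L ≥ 2`, `0 < w ≤ M` measurable with `Haar{w = M} = 0`, `T` a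
NONEMPTY set of plaquettes (`k = #T`): the configurations on which `∏_{p∈T} w(U_p)` attains `M^k` are
`Haar^{⊗E}`-null — they have `w(U_{p₀}) = M` at any `p₀ ∈ T`. [ours] -/
theorem pi_haar_prodWeight_eq_max_null (hL : 2 ≤ L) {w : G → ℝ} (hwm : Measurable w) (hw0 : ∀ g, 0 < w g)
    {M : ℝ} (hM : ∀ g, w g ≤ M) (hnull : haarProbability G {g | w g = M} = 0)
    (T : Finset (Plaquette d L)) (hT : T.Nonempty) :
    (Measure.pi fun _ : Edge d L => haarProbability G)
      {U | ∏ p ∈ T, w (plaquetteHolonomy U p.1 p.2.1.1 p.2.1.2) = M ^ T.card} = 0 := by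
  classical
  obtain ⟨p₀, hp₀⟩ := hT
  have hMpos : 0 < M := (hw0 1).trans_le (hM 1)
  -- `{F = M^k} ⊆ {w(U_{p₀}) = M}`
  have hsub : {U : GaugeConfig d L G | ∏ p ∈ T, w (plaquetteHolonomy U p.1 p.2.1.1 p.2.1.2) = M ^ T.card} ⊆
      {U | plaquetteHolonomy U p₀.1 p₀.2.1.1 p₀.2.1.2 ∈ {g | w g = M}} := by
    intro U hU
    simp only [Set.mem_setOf_eq] at hU ⊢
    by_contra hne
    have hlt : w (plaquetteHolonomy U p₀.1 p₀.2.1.1 p₀.2.1.2) < M := lt_of_le_of_ne (hM _) hne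
    have hprod : ∏ p ∈ T, w (plaquetteHolonomy U p.1 p.2.1.1 p.2.1.2) < M ^ T.card := by
      rw [← Finset.mul_prod_erase T _ hp₀, ← Finset.card_erase_add_one hp₀, pow_succ']
      have hrest : ∏ p ∈ T.erase p₀, w (plaquetteHolonomy U p.1 p.2.1.1 p.2.1.2) ≤ M ^ (T.erase p₀).card := by
        rw [← Finset.prod_const]
        exact Finset.prod_le_prod (fun p _ => (hw0 _).le) fun p _ => hM _
      have hrestpos : 0 < ∏ p ∈ T.erase p₀, w (plaquetteHolonomy U p.1 p.2.1.1 p.2.1.2) :=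
        prod_pos fun p _ => hw0 _
      calc w (plaquetteHolonomy U p₀.1 p₀.2.1.1 p₀.2.1.2) *
            ∏ p ∈ T.erase p₀, w (plaquetteHolonomy U p.1 p.2.1.1 p.2.1.2)
          < M * ∏ p ∈ T.erase p₀, w (plaquetteHolonomy U p.1 p.2.1.1 p.2.1.2) :=
            mul_lt_mul_of_pos_right hlt hrestpos
        _ ≤ M * M ^ (T.erase p₀).card := mul_le_mul_of_nonneg_left hrest hMpos.le
    exact absurd hU (ne_of_lt hprod)
  have hN : MeasurableSet {g : G | w g = M} := hwm (measurableSet_singleton M)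
  have hreal : (Measure.pi fun _ : Edge d L => haarProbability G).real
      {U | plaquetteHolonomy U p₀.1 p₀.2.1.1 p₀.2.1.2 ∈ {g | w g = M}} = 0 := by
    rw [pi_haar_real_plaquetteHolonomy_preimage hL p₀.1 (ne_of_lt p₀.2.2) hN, measureReal_def, hnull,
      ENNReal.toReal_zero]
  have hzero : (Measure.pi fun _ : Edge d L => haarProbability G)
      {U | plaquetteHolonomy U p₀.1 p₀.2.1.1 p₀.2.1.2 ∈ {g | w g = M}} = 0 := by
    rwa [measureReal_eq_zero_iff (measure_ne_top _ _)] at hreal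
  exact measure_mono_null hsub hzero

/-! ## §3 The frozen event can be made rare -/

/-- **`sup_f τ_int(f) ≥ 1/(ε + 2(M₂/M)^s) − 1/2` FOR EVERY `ε > 0`.**  Setting of `closing_volumeFloor`
(`L ≥ 2`; `w` continuous, `0 < m ≤ w ≤ M`; two-plaquette constant `M₂`; `(B, t, rank)` ranked with a closing
section `(S, u)` of size `s`, `k = #Bᶜ ≥ 1`; target `π`, block proposal `q`, exact sampler
`K = indepMH q (Z_B F_R/Z)`), and moreover `w(1) = M` with `Haar{w = M} = 0`.  Then for every `ε > 0`
there is an event `A` (a neighbourhood `{F_R > θ M^k}` of the cold configuration, `θ ∈ [1/2, 1)`) with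
`0 < π(A) < ε` and `τ_int(1_A − π(A)) ≥ 1/(ε + 2·(M₂/M)^s) − 1/2`. [ours] -/
theorem closing_event_tauInt_ge_of_null (hL : 2 ≤ L) {w : G → ℝ} (hw : Continuous w) {m M : ℝ}
    (hm0 : 0 < m) (hm : ∀ g, m ≤ w g) (hM : ∀ g, w g ≤ M) (hw1 : w 1 = M)
    (hnull : haarProbability G {g | w g = M} = 0) {M₂ : ℝ}
    (hM₂ : ∀ a b : G, ∫ h, w h * w (a * h * b) ∂(haarProbability G) ≤
      (∫ g, w g ∂(haarProbability G)) * M₂)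
    (hM₂' : ∀ a b : G, ∫ h, w h * w (a * h⁻¹ * b) ∂(haarProbability G) ≤
      (∫ g, w g ∂(haarProbability G)) * M₂)
    (B : Finset (Plaquette d L)) (hB : (Finset.univ \ B).Nonempty) (t : Plaquette d L → Edge d L)
    (ht : ∀ p ∈ B, t p ∈ ({(p.1, p.2.1.1), (p.1.shift p.2.1.1, p.2.1.2),
        (p.1.shift p.2.1.2, p.2.1.1), (p.1, p.2.1.2)} : Finset (Edge d L)))
    (rank : Plaquette d L → ℕ)
    (hrank : ∀ p ∈ B, ∀ p' ∈ B, p ≠ p' → t p ∈ ({(p'.1, p'.2.1.1), (p'.1.shift p'.2.1.1, p'.2.1.2),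
        (p'.1.shift p'.2.1.2, p'.2.1.1), (p'.1, p'.2.1.2)} : Finset (Edge d L)) → rank p < rank p')
    (S : Finset (Plaquette d L)) (u : Plaquette d L → Plaquette d L) (hSB : ∀ p' ∈ S, p' ∉ B)
    (huB : ∀ p' ∈ S, u p' ∈ B)
    (hut : ∀ p' ∈ S, t (u p') ∈ ({(p'.1, p'.2.1.1), (p'.1.shift p'.2.1.1, p'.2.1.2),
        (p'.1.shift p'.2.1.2, p'.2.1.1), (p'.1, p'.2.1.2)} : Finset (Edge d L)))
    (humax : ∀ p' ∈ S, ∀ p ∈ B, p ≠ u p' → t p ∈ ({(p'.1, p'.2.1.1), (p'.1.shift p'.2.1.1, p'.2.1.2),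
        (p'.1.shift p'.2.1.2, p'.2.1.1), (p'.1, p'.2.1.2)} : Finset (Edge d L)) → rank p < rank (u p'))
    (huinj : Set.InjOn u S)
    (π q : Measure (GaugeConfig d L G)) [IsProbabilityMeasure π] [IsProbabilityMeasure q]
    (hπ : π = (Measure.pi fun _ : Edge d L => haarProbability G).withDensity fun U =>
      ENNReal.ofReal ((∏ p : Plaquette d L, w (plaquetteHolonomy U p.1 p.2.1.1 p.2.1.2)) /
        ∫ V, ∏ p : Plaquette d L, w (plaquetteHolonomy V p.1 p.2.1.1 p.2.1.2)
          ∂(Measure.pi fun _ : Edge d L => haarProbability G)))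
    (hq : q = (Measure.pi fun _ : Edge d L => haarProbability G).withDensity fun U =>
      ENNReal.ofReal ((∏ p ∈ B, w (plaquetteHolonomy U p.1 p.2.1.1 p.2.1.2)) /
        ∫ V, ∏ p ∈ B, w (plaquetteHolonomy V p.1 p.2.1.1 p.2.1.2)
          ∂(Measure.pi fun _ : Edge d L => haarProbability G)))
    {ε : ℝ} (hε : 0 < ε) :
    ∃ A : Set (GaugeConfig d L G), MeasurableSet A ∧ 0 < π.real A ∧ π.real A < ε ∧
      1 / (ε + 2 * (M₂ / M) ^ S.card) - 1 / 2 ≤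
        tauInt (fun n => autocov (indepMH q fun U =>
          ((∫ V, ∏ p : Plaquette d L, w (plaquetteHolonomy V p.1 p.2.1.1 p.2.1.2)
              ∂(Measure.pi fun _ : Edge d L => haarProbability G)) /
            ((∫ V, ∏ p ∈ B, w (plaquetteHolonomy V p.1 p.2.1.1 p.2.1.2)
              ∂(Measure.pi fun _ : Edge d L => haarProbability G)) *
              ∏ p ∈ Finset.univ \ B, w (plaquetteHolonomy U p.1 p.2.1.1 p.2.1.2)))⁻¹) π
            (fun U => A.indicator (fun _ => (1 : ℝ)) U - π.real A) n /
          autocov (indepMH q fun U =>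
          ((∫ V, ∏ p : Plaquette d L, w (plaquetteHolonomy V p.1 p.2.1.1 p.2.1.2)
              ∂(Measure.pi fun _ : Edge d L => haarProbability G)) /
            ((∫ V, ∏ p ∈ B, w (plaquetteHolonomy V p.1 p.2.1.1 p.2.1.2)
              ∂(Measure.pi fun _ : Edge d L => haarProbability G)) *
              ∏ p ∈ Finset.univ \ B, w (plaquetteHolonomy U p.1 p.2.1.1 p.2.1.2)))⁻¹) π
            (fun U => A.indicator (fun _ => (1 : ℝ)) U - π.real A) 0) := by
  set Haar : Measure (GaugeConfig d L G) := Measure.pi fun _ : Edge d L => haarProbability G with hHaar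
  set FT : GaugeConfig d L G → ℝ := fun U => ∏ p : Plaquette d L, w (plaquetteHolonomy U p.1 p.2.1.1 p.2.1.2)
    with hFT
  set FR : GaugeConfig d L G → ℝ := fun U => ∏ p ∈ Finset.univ \ B, w (plaquetteHolonomy U p.1 p.2.1.1 p.2.1.2)
    with hFR
  set ZT : ℝ := ∫ V, FT V ∂Haar with hZT
  set k : ℕ := (Finset.univ \ B).card with hk
  set s : ℕ := S.card with hs
  have hw0 : ∀ g, 0 < w g := fun g => hm0.trans_le (hm g)
  have hMpos : 0 < M := (hw0 1).trans_le (hM 1)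
  haveI : IsProbabilityMeasure Haar := by rw [hHaar]; infer_instance
  have hFTc : Continuous FT := continuous_prodPlaquetteWeight_anyDim hw Finset.univ
  have hFRc : Continuous FR := continuous_prodPlaquetteWeight_anyDim hw (Finset.univ \ B)
  have hFTpos : ∀ U, 0 < FT U := fun U => prod_pos fun p _ => hw0 _
  have hFRle : ∀ U, FR U ≤ M ^ k := fun U => (pow_le_prodPlaquetteWeight_le_pow_anyDim hm0 hm hM _ U).2
  have hFTi : Integrable FT Haar := by
    refine Integrable.mono' (integrable_const (M ^ (Finset.univ : Finset (Plaquette d L)).card))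
      hFTc.aestronglyMeasurable (ae_of_all _ fun U => ?_)
    rw [Real.norm_eq_abs, abs_of_pos (hFTpos U)]
    exact (pow_le_prodPlaquetteWeight_le_pow_anyDim hm0 hm hM _ U).2
  have hZTpos : 0 < ZT := by
    have h := integral_mono (integrable_const (m ^ (Finset.univ : Finset (Plaquette d L)).card)) hFTi
      fun U => (pow_le_prodPlaquetteWeight_le_pow_anyDim hm0 hm hM _ U).1
    rw [integral_const, smul_eq_mul, probReal_univ, one_mul] at h
    exact lt_of_lt_of_le (pow_pos hm0 _) h
  have hM₂0 : 0 ≤ M₂ := by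
    have hc : 0 < ∫ g, w g ∂(haarProbability G) := haarProbability_integral_pos_of_continuous_pos hw hw0
    have h1 := hM₂ 1 1
    have h0 : 0 ≤ ∫ h, w h * w (1 * h * 1) ∂(haarProbability G) :=
      integral_nonneg fun h => mul_nonneg (hw0 _).le (hw0 _).le
    exact (mul_nonneg_iff_of_pos_left hc).1 (h0.trans h1)
  have hMM : 0 ≤ (M₂ / M) ^ s := pow_nonneg (div_nonneg hM₂0 hMpos.le) _
  -- the events `A n = {F_R > (1 − 1/(n+2)) M^k}` decrease to the null set `{F_R = M^k}`
  set θ : ℕ → ℝ := fun n => 1 - 1 / ((n : ℝ) + 2) with hθ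
  have hn2 : ∀ n : ℕ, (1 : ℝ) / ((n : ℝ) + 2) ≤ 1 / 2 := fun n =>
    one_div_le_one_div_of_le (by norm_num) (by have := (Nat.cast_nonneg n : (0 : ℝ) ≤ n); linarith)
  have hθpos : ∀ n, 0 < θ n := fun n => by
    have := hn2 n; simp only [hθ]; linarith
  have hθhalf : ∀ n, 1 / 2 ≤ θ n := fun n => by
    have := hn2 n; simp only [hθ]; linarith
  have hθlt : ∀ n, θ n < 1 := fun n => by
    have : (0 : ℝ) < 1 / ((n : ℝ) + 2) := by positivity
    simp only [hθ]; linarith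
  set A : ℕ → Set (GaugeConfig d L G) := fun n => {U | θ n * M ^ k < FR U} with hA
  have hAmeas : ∀ n, MeasurableSet (A n) := fun n => measurableSet_lt measurable_const hFRc.measurable
  have hAopen : ∀ n, IsOpen (A n) := fun n => isOpen_lt continuous_const hFRc
  have hAanti : Antitone A := by
    intro i j hij U hU
    simp only [hA, Set.mem_setOf_eq] at hU ⊢
    have hθij : θ i ≤ θ j := by
      simp only [hθ]
      have : (1 : ℝ) / ((j : ℝ) + 2) ≤ 1 / ((i : ℝ) + 2) :=
        one_div_le_one_div_of_le (by positivity) (by exact_mod_cast Nat.add_le_add_right hij 2)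
      linarith
    exact lt_of_le_of_lt (mul_le_mul_of_nonneg_right hθij (pow_nonneg hMpos.le _)) hU
  have hAinter : ⋂ n, A n ⊆ {U | FR U = M ^ k} := by
    intro U hU
    simp only [Set.mem_iInter, hA, Set.mem_setOf_eq] at hU
    refine le_antisymm (hFRle U) ?_
    by_contra hlt
    push Not at hlt
    have hMk : 0 < M ^ k := pow_pos hMpos _
    -- `F_R U < M^k`: pick `n` with `1/(n+2) < (M^k − F_R U)/M^k`
    obtain ⟨n, hn⟩ := exists_nat_one_div_lt (div_pos (sub_pos.2 hlt) hMk)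
    have h1 : (1 : ℝ) / ((n : ℝ) + 2) ≤ 1 / ((n : ℝ) + 1) :=
      one_div_le_one_div_of_le (by positivity) (by linarith)
    have h2 := hU n
    simp only [hθ] at h2
    have h3 : (1 - 1 / ((n : ℝ) + 2)) * M ^ k ≥ (1 - (M ^ k - FR U) / M ^ k) * M ^ k :=
      mul_le_mul_of_nonneg_right (by linarith) hMk.le
    have h4 : (1 - (M ^ k - FR U) / M ^ k) * M ^ k = FR U := by field_simp; ring
    linarith
  -- `π` of the limit set is `0`
  have hnullT : Haar {U | FR U = M ^ k} = 0 :=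
    pi_haar_prodWeight_eq_max_null hL hw.measurable hw0 hM hnull (Finset.univ \ B) hB
  have hπac : π ≪ Haar := by rw [hπ]; exact withDensity_absolutelyContinuous _ _
  have hπlim : π (⋂ n, A n) = 0 := measure_mono_null hAinter (hπac hnullT)
  have htend : Tendsto (fun n => π (A n)) atTop (𝓝 (π (⋂ n, A n))) :=
    tendsto_measure_iInter_atTop (fun n => (hAmeas n).nullMeasurableSet) hAanti ⟨0, measure_ne_top _ _⟩
  rw [hπlim] at htend
  obtain ⟨n, hn⟩ := (htend.eventually (gt_mem_nhds (ENNReal.ofReal_pos.2 hε))).exists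
  have hsmall : π.real (A n) < ε := by
    rw [measureReal_def]
    have := (ENNReal.toReal_lt_toReal (measure_ne_top _ _) ENNReal.ofReal_ne_top).2 hn
    rwa [ENNReal.toReal_ofReal hε.le] at this
  -- `π(A n) > 0`: an open neighbourhood of the cold configuration under a positive density
  have hcold : (fun _ : Edge d L => (1 : G)) ∈ A n := by
    simp only [hA, Set.mem_setOf_eq, hFR]
    rw [prod_plaquetteWeight_cold, hw1]
    exact mul_lt_of_lt_one_left (pow_pos hMpos _) (hθlt n)
  have hHaarpos : 0 < Haar (A n) := (hAopen n).measure_pos Haar ⟨_, hcold⟩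
  have hπpos : 0 < π.real (A n) := by
    rw [measureReal_def, ENNReal.toReal_pos_iff]
    refine ⟨?_, measure_lt_top _ _⟩
    rw [hπ, withDensity_apply _ (hAmeas n)]
    have hc : ∀ U, ENNReal.ofReal (m ^ (Finset.univ : Finset (Plaquette d L)).card / ZT) ≤
        ENNReal.ofReal (FT U / ZT) := fun U =>
      ENNReal.ofReal_le_ofReal (div_le_div_of_nonneg_right
        (pow_le_prodPlaquetteWeight_le_pow_anyDim hm0 hm hM _ U).1 hZTpos.le)
    calc (0 : ℝ≥0∞) < ENNReal.ofReal (m ^ (Finset.univ : Finset (Plaquette d L)).card / ZT) * Haar (A n) :=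
          ENNReal.mul_pos (ENNReal.ofReal_pos.2 (div_pos (pow_pos hm0 _) hZTpos)).ne' hHaarpos.ne'
      _ = ∫⁻ _ in A n, ENNReal.ofReal (m ^ (Finset.univ : Finset (Plaquette d L)).card / ZT) ∂Haar := by
          rw [setLIntegral_const]
      _ ≤ ∫⁻ U in A n, ENNReal.ofReal (FT U / ZT) ∂Haar := lintegral_mono fun U => hc U
  -- the floor at `θ n ≥ 1/2`
  have hfloor := (closing_volumeFloor (G := G) hL hw hm0 hm hM hM₂ hM₂' B t ht rank hrank S u hSB huB
    hut humax huinj π q hπ hq).2 (θ n) (hθpos n) (A n) (hAmeas n) (fun U hU => hU) hπpos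
  refine ⟨A n, hAmeas n, hπpos, hsmall, le_trans ?_ hfloor⟩
  have hden : π.real (A n) + (M₂ / M) ^ s / θ n ≤ ε + 2 * (M₂ / M) ^ s := by
    have h1 : (M₂ / M) ^ s / θ n ≤ (M₂ / M) ^ s / (1 / 2) :=
      div_le_div_of_nonneg_left hMM (by norm_num) (hθhalf n)
    rw [div_div_eq_mul_div, div_one] at h1
    linarith
  have hpos2 : 0 < π.real (A n) + (M₂ / M) ^ s / θ n :=
    add_pos_of_pos_of_nonneg hπpos (div_nonneg hMM (hθpos n).le)
  have := one_div_le_one_div_of_le hpos2 hden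
  linarith

end Summit.Ventures.LatticeQCDFlow.Theory2.Autoregressive

end
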